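import Summits.ResolutionOfSingularities.ResolutionOfSingularities.Theorems.FrobeniusLadderFInjectiveMacaulayficationE8ChartXPoints
import HarnessLib

/-!
# The `X₁`-chart of the second blow-up of `E₈⁰` (characteristic `3`) is regular along the exceptional divisor

Support file for crux stmt-ResolutionOfSingularities-15315 (`FrobeniusLadder.FInjectiveMacaulayfication`,
line `Sketch`): stub `stub_e7ChartX1Points` of the calibration of the crux's blow-up engine — the second
step of the characteristic-`3` tower for `E₈⁰`, i.e. the point blow-up of the `E₇⁰`-type point
`k[X]/(X₂² + X₁X₀³ + X₁³)` at the origin.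

The `X₁`-chart of this blow-up is the hypersurface ring `S/(h₁)`, `S = k[X₀, X₁, X₂]`,
`h₁ = X₂² + X₁ + X₀³X₁²`, with exceptional divisor `X₁ = 0`. The blow-up glue needs the Cohen–Macaulay +
Frobenius-closed clause of the crux (inline form, `p = 3`) at the local ring `(S/(h₁))_Q` of every MAXIMAL
ideal `Q` of `S/(h₁)` on the exceptional divisor (`X̄₁ ∈ Q`). Every such point is REGULAR, by the
Jacobian criterion in the `X₁`-direction:

* `pderiv_one_h1` — `∂h₁/∂X₁ = 1 + X₁ · (2 X₀³)`.
* `pderiv_one_h1_not_mem` — hence `∂h₁/∂X₁ ∉ P` for every proper ideal `P ∋ X₁` of `S` (else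
  `1 = ∂h₁/∂X₁ - X₁ · (2 X₀³) ∈ P`).
* `charP_three_localization_atPrime_quotient` — the local rings `(S/(g))_Q` have characteristic `3`
  (they are non-trivial `k`-algebras, `CharP.of_ringHom_of_ne_zero`).
* `stub_e7ChartX1Points` — the registered form: with `P := Q ∩ S ∋ X₁`, the Jacobian criterion
  `HypersurfaceRegular.stub_hypersurfaceRegularOfPderiv` (Matsumura Thm. 30.4 (ii), direction `i = 1`) makes
  `(S/(h₁))_Q` a regular local ring, and `FiClauseOfRegular.stub_fiClauseOfRegular` (`p = 3`: regular
  local rings of prime characteristic satisfy the clause — Matsumura Thm. 17.4 and Kunz) gives the clause.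

References: H. Matsumura, *Commutative Ring Theory*, Cambridge Stud. Adv. Math. 8, CUP 1986,
Thm. 30.4 (ii) [Matsumura1987]; the computation of the chart and its derivative is folklore.
-/

-- single-problem summit: the doubled namespace component is forced
set_option linter.dupNamespace false

noncomputable section

namespace Summit.ResolutionOfSingularities.ResolutionOfSingularities.Theorems.FInjectiveMacaulayfication.E7ChartX1Points

open MvPolynomial

/-- **The derivative of the `X₁`-chart equation in the exceptional direction**:
`∂(X₂² + X₁ + X₀³X₁²)/∂X₁ = 1 + X₁ · (2 X₀³)` in `k[X₀, X₁, X₂]` (any commutative ring `k`). [folklore] -/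
theorem pderiv_one_h1 (k : Type) [CommRing k] :
    pderiv 1 (X 2 ^ 2 + X 1 + X 0 ^ 3 * X 1 ^ 2 : MvPolynomial (Fin 3) k) =
      1 + X 1 * (2 * X 0 ^ 3) := by
  simp only [map_add, pderiv_mul, pderiv_pow, pderiv_X_self,
    pderiv_X_of_ne (show (2 : Fin 3) ≠ 1 by decide), pderiv_X_of_ne (show (0 : Fin 3) ≠ 1 by decide),
    Nat.cast_ofNat]
  ring

/-- **The exceptional direction is a regular direction**: for every proper ideal `P ∋ X₁` of `k[X₀, X₁, X₂]`,
`∂h₁/∂X₁ = 1 + X₁ · (2 X₀³) ∉ P` — otherwise `1 = ∂h₁/∂X₁ - X₁ · (2 X₀³) ∈ P`. [folklore] -/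
theorem pderiv_one_h1_not_mem (k : Type) [CommRing k] (P : Ideal (MvPolynomial (Fin 3) k))
    (hP : P ≠ ⊤) (hX : (X 1 : MvPolynomial (Fin 3) k) ∈ P) :
    pderiv 1 (X 2 ^ 2 + X 1 + X 0 ^ 3 * X 1 ^ 2 : MvPolynomial (Fin 3) k) ∉ P := by
  intro hmem
  refine hP ((Ideal.eq_top_iff_one P).mpr ?_)
  have h1 := P.sub_mem hmem (P.mul_mem_right (2 * X 0 ^ 3) hX)
  rwa [pderiv_one_h1, add_sub_cancel_right] at h1

/-- **Local rings of a hypersurface over a field of characteristic `3` have characteristic `3`**: for a prime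
`Q` of `k[X₀, X₁, X₂]/(g)`, the localization `(k[X]/(g))_Q` is a non-trivial (local) `k`-algebra, and a
non-trivial algebra over a field inherits its prime characteristic (`CharP.of_ringHom_of_ne_zero`).
[folklore] -/
theorem charP_three_localization_atPrime_quotient (k : Type) [Field k] [CharP k 3]
    (g : MvPolynomial (Fin 3) k) (Q : Ideal (MvPolynomial (Fin 3) k ⧸ Ideal.span {g})) [Q.IsPrime] :
    CharP (Localization.AtPrime Q) 3 :=
  CharP.of_ringHom_of_ne_zero (algebraMap k (Localization.AtPrime Q)) 3 (by decide)

/-- **The `X₁`-chart of the blow-up of the `E₇⁰`-type point is regular along the exceptional divisor**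
(registered stub `stub_e7ChartX1Points`, second step of the characteristic-`3` tower for `E₈⁰`): for a
field `k` of characteristic `3`, `h₁ = X₂² + X₁ + X₀³X₁²` and every maximal ideal `Q ∋ X̄₁` of
`k[X₀, X₁, X₂]/(h₁)`, the local ring `(k[X]/(h₁))_Q` satisfies the crux's clause: every system of
parameters is a weakly regular sequence and generates a Frobenius closed ideal (inline form, `p = 3`).
Proof: `P := Q ∩ k[X]` is a proper ideal containing `X₁`, so `∂h₁/∂X₁ ∉ P` (`pderiv_one_h1_not_mem`); the
Jacobian criterion (`HypersurfaceRegular.stub_hypersurfaceRegularOfPderiv`, Matsumura Thm. 30.4 (ii)) makes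
`(k[X]/(h₁))_Q` regular local, of characteristic `3` (`charP_three_localization_atPrime_quotient`), and
regular local rings of prime characteristic satisfy the clause (`FiClauseOfRegular.stub_fiClauseOfRegular`).
[cite: Matsumura1987, Thm. 30.4 (ii)] -/
theorem stub_e7ChartX1Points : ∀ (k : Type) [Field k] [CharP k 3] (h1 : MvPolynomial (Fin 3) k),
    h1 = MvPolynomial.X 2 ^ 2 + MvPolynomial.X 1 + MvPolynomial.X 0 ^ 3 * MvPolynomial.X 1 ^ 2 →
    ∀ (Q : Ideal (MvPolynomial (Fin 3) k ⧸ Ideal.span {h1})) [Q.IsMaximal],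
      Ideal.Quotient.mk (Ideal.span {h1}) (MvPolynomial.X 1) ∈ Q →
      ∀ d : ℕ, ringKrullDim (Localization.AtPrime Q) = d → ∀ s : Fin d → Localization.AtPrime Q,
        (Ideal.span (Set.range s)).radical.IsMaximal →
          RingTheory.Sequence.IsWeaklyRegular (Localization.AtPrime Q) (List.ofFn s) ∧
          ∀ y : Localization.AtPrime Q, (∃ e : ℕ, y ^ 3 ^ e ∈ Ideal.span
            ((fun z : Localization.AtPrime Q => z ^ 3 ^ e) ''
              (Ideal.span (Set.range s) : Set (Localization.AtPrime Q)))) → y ∈ Ideal.span (Set.range s) := by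
  intro k _ _ h1 hh1 Q hQ hX1 d hd s hs
  subst hh1
  -- the prime `P = Q ∩ k[X]` above `Q` is proper and contains `X₁`, so `∂h₁/∂X₁ ∉ P`
  have hder := pderiv_one_h1_not_mem k _ (Ideal.comap_ne_top _ hQ.ne_top) (Ideal.mem_comap.mpr hX1)
  -- Jacobian criterion: the local ring is regular
  haveI : IsRegularLocalRing (Localization.AtPrime Q) :=
    HypersurfaceRegular.stub_hypersurfaceRegularOfPderiv k 3 _ 1 Q hder
  haveI : CharP (Localization.AtPrime Q) 3 := charP_three_localization_atPrime_quotient k _ Q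
  haveI : Fact (Nat.Prime 3) := ⟨Nat.prime_three⟩
  -- regular local rings of characteristic `3` satisfy the clause
  exact (FiClauseOfRegular.stub_fiClauseOfRegular 3 (Localization.AtPrime Q)).2 d hd s hs

end Summit.ResolutionOfSingularities.ResolutionOfSingularities.Theorems.FInjectiveMacaulayfication.E7ChartX1Points

end
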